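import Mathlib
import Literature.NumberTheory.LFunctions.Zhang2022.TypedSection12B
import HarnessLib

/-!
# Zhang (2022) §12, Lemma 12.2: the Cauchy step (Z22:§12.u026) from the two analytic displays, and
# (12.10) with the rate `O(𝓛⁻¹⁵)` from the displayed steps, kernel-checked

Topic `Literature/NumberTheory/LFunctions/Zhang2022` (Landau–Siegel audit tree; verdict-neutral).
Y. Zhang, *Discrete mean estimates and the Landau–Siegel zero*, arXiv:2211.02515v1 (2022)
[Zhang2022LandauSiegel] — **an unrefereed manuscript under adjudication; nothing here asserts or
denies its Theorems 1–2, and no claim about Landau–Siegel zeros is made.** Cell siegel-zhang, D-0069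
campaign, discharge seat sz-d60 (L3 free item F4: the Lemma 12.2 deduction; DAG nodes Z22:Lem12.2.pf,
Z22:§12.u026, Z22:(12.10)); the displayed steps are L3-t5's typed nodes (`TypedSection12B`,
namespace `…Typed.Sec12B`), cited BY NAME as hypotheses, never restated. Companion of
`Section12Lemma123Edge` (the same engine for Lemma 12.3).

The printed proof of Lemma 12.2 [Z22 pp. 69–70, tex L3518–L3549]: the `l`-sum is
`−(1/log P₁)∂_w{(dr/P″₁)^{β₆−w}Σ_{P″₁/dr<l<P″₂/dr} χ(l)ξ_j(l;d,r)l^{−(1−β₆+w)}}|_{w=0}` (u023, `U023`,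
exact); "Suppose `dr ≤ P″₁/T` … for `|w| = α` [the inner sum] = [g-series] + O(𝓛⁻¹⁵) = [Perron
integral] + O(𝓛⁻¹⁵)" (u024, `U024`); "In a way similar to the proof of Lemma 8.4 … the right side is
`L′(1,χ)Π(d,r)·(2πi)⁻¹∫_{|s|=5α}… + O(𝓛⁻¹⁵) = L′(1,χ)Π(d,r)β_{j+1}β_{j+2}((P″₂/dr)^{β₆−w} −
(P″₁/dr)^{β₆−w})/(β₆−w) + O(𝓛⁻¹⁵)`" (u025, `U025`); "**It follows by Cauchy' integral formula that**
`∂_w(…)|_{w=0} = [L′(1,χ)Π(d,r)β_{j+1}β_{j+2}]·∂_w(∫₁^{P^{0.004}}y^{β₆−w−1}dy)|_{w=0} + O(𝓛⁻⁶)`"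
(u026; `U026read` is the reading with the bracketed factor, which the print omits); "The main term …
is, by substituting `y = P^z`, equal to `−(log P)²∫₀^{0.004} ze^{3πiz/2}dz`" (u027, `U027`, exact);
"Gathering these results together we obtain (12.10)" — whose error term is BLANK in print
(`Eq1210 E`; `Eq1210L15` = the rate `O(𝓛⁻¹⁵)` this chain supports).

Kernel-checked here:

* `u026read_of_u024_u025 : U024 c′ → U025 c′ → U026read c′` — **the Cauchy step u026 PROVED from
  the two analytic displays**: with `E(w) := bracket122(w) − L′Πβ_{j+1}β_{j+2}·modelInt026(w)`,
  holomorphic on `|w| < 1.2α` (`β₆ = 3iα/2`; `∫₁^{P^{0.004}}y^{β₆−w−1}dy = (P^{0.004(β₆−w)} − 1)/(β₆−w)`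
  there), and `(dr/P″₁)^{β₆−w}·circ025(w) = β_{j+1}β_{j+2}·modelInt026(w)` EXACTLY (`P″₂/P″₁ = P^{0.004}`,
  `(dr/P″₁)(P″₁/dr) = 1`; u025's closed form), one has `|E(w)| ≤ (P″₁/dr)^{α}·(C₂₄+C₂₅)𝓛⁻¹⁵` on
  `|w| = α`, `(P″₁/dr)^{α} ≤ P″₁^{α} ≤ e^{521π}` (`α log P″₁ = 0.496π + π(𝓛 + 519 log 𝓛)𝓛⁻⁹`), hence
  `|E′(0)| ≤ e^{521π}(C₂₄+C₂₅)𝓛⁻¹⁵/α = O(𝓛⁻⁶)` (Mathlib `Complex.norm_deriv_le_of_forall_mem_sphere_norm_le`);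
* `eq1210L15_of_steps : U023 c′ → U026read c′ → U027 → Eq1210L15 c′` — (12.10) with the rate
  `O(𝓛⁻¹⁵)`: `−(1/log P₁)·L′Πβ_{j+1}β_{j+2}·(−(log P)²∫₀^{0.004}ze^{3πiz/2}dz) = b*L′(1,χ)Π(d,r)(log P)
  β_{j+1}β_{j+2}` as `log P₁ = 0.504 log P`, `b* = (1/0.504)∫₀^{0.004}ze^{3πiz/2}dz` (tree `bstar`);
* `lemma122L15_of_steps : U023 → U024 → U025 → U027 → Eq1211 → Lemma122 c′ (𝓛⁻¹⁵)` and
  `ded122L15_of_eq1211` — (12.11)'s proof is the sentence "similar to that of ." (blank reference,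
  GAP row G-L3t5-2), so `Eq1211` remains a hypothesis.

No new definitions, no new facts; standard axioms.

## References

* Y. Zhang, arXiv:2211.02515v1 (2022), §12 Lemma 12.2 and its proof, (12.10)–(12.11), pp. 69–70,
  tex L3502–L3549; (2.10), (2.21)–(2.22), §12 p. 67 (`P″₁ = P^{0.496}Dt₀`, `P″₂ = P^{0.5}Dt₀`).
  [cite: Zhang2022LandauSiegel, §12 Lemma 12.2]
-/

noncomputable section

open Complex Real ComplexConjugate Metric Set MeasureTheory

namespace Literature.NumberTheory.LFunctions.Zhang2022.Typed.Sec12B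

open Literature.NumberTheory.LFunctions.Zhang2022.Skeleton

/-! ## Elementary facts about the parameters (`D ≥ 3`) -/

section Params122

variable {D : ℕ}

/-- `log P = 𝓛⁹`. [cite: Zhang2022LandauSiegel, §2 (2.6)] -/
private theorem log_bigP_eq' (D : ℕ) : Real.log (bigP D) = ell D ^ 9 := by
  rw [bigP, Real.log_exp]

/-- `α = π/𝓛⁹ > 0` for `D ≥ 3`. [cite: Zhang2022LandauSiegel, §2 (2.10)] -/
private theorem alpha_pos_of' (hD : 3 ≤ D) : 0 < alpha D := by
  rw [alpha, log_bigP_eq']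
  exact div_pos Real.pi_pos (pow_pos (by linarith [one_lt_ell hD]) _)

/-- `α = π/𝓛⁹`. [cite: Zhang2022LandauSiegel, §2 (2.10)] -/
private theorem alpha_eq (D : ℕ) : alpha D = π / ell D ^ 9 := by
  rw [alpha, log_bigP_eq']

/-- `log P₁ = 0.504·log P > 0`. [cite: Zhang2022LandauSiegel, §2 (2.21)] -/
private theorem log_P1_eq' (D : ℕ) : Real.log (Skeleton.P1 D) = 0.504 * Real.log (bigP D) := by
  rw [Skeleton.P1, Real.log_rpow (by rw [bigP]; exact Real.exp_pos _)]

/-- `log P₁ > 0` for `D ≥ 3`. [cite: Zhang2022LandauSiegel, §2 (2.21)] -/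
private theorem log_P1_pos' (hD : 3 ≤ D) : 0 < Real.log (Skeleton.P1 D) := by
  rw [log_P1_eq', log_bigP_eq']; exact mul_pos (by norm_num) (pow_pos (by linarith [one_lt_ell hD]) _)

/-- `P″₁ > 0`, `P″₂ > 0`, `t₀ > 0` for `D ≥ 3`. [cite: Zhang2022LandauSiegel, §12 p. 67] -/
private theorem t0_pos' (hD : 3 ≤ D) : 0 < t0 D := by
  rw [t0]; exact pow_pos (by linarith [one_lt_ell hD]) _

/-- `P″₂ > 0` for `D ≥ 3`. [cite: Zhang2022LandauSiegel, §12 p. 67] -/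
private theorem P2pp_pos' (hD : 3 ≤ D) : 0 < P2pp D := by
  have h1 : 0 < bigP D ^ (0.5 : ℝ) := Real.rpow_pos_of_pos (Real.exp_pos _) _
  have h2 : (0 : ℝ) < D := by exact_mod_cast (lt_of_lt_of_le (by norm_num) hD : 0 < D)
  rw [P2pp]; exact mul_pos (mul_pos h1 h2) (t0_pos' hD)

/-- `P″₂/P″₁ = P^{0.004}`. [cite: Zhang2022LandauSiegel, §12 p. 67] -/
private theorem P2pp_div_P1pp (hD : 3 ≤ D) : P2pp D / P1pp D = bigP D ^ (0.004 : ℝ) := by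
  have hP : 0 < bigP D := Real.exp_pos _
  have h2 : (0 : ℝ) < D := by exact_mod_cast (lt_of_lt_of_le (by norm_num) hD : 0 < D)
  have ht := t0_pos' hD
  rw [P2pp, P1pp, show (0.004 : ℝ) = 0.5 - 0.496 by norm_num, Real.rpow_sub hP]
  field_simp

/-- `α·log P″₁ ≤ 521π`: `log P″₁ = 0.496𝓛⁹ + 𝓛 + 519 log 𝓛 ≤ 0.496𝓛⁹ + 520𝓛`, `α = π/𝓛⁹`, `𝓛 ≥ 1`.
[cite: Zhang2022LandauSiegel, §12 p. 67] -/
private theorem alpha_mul_log_P1pp_le (hD : 3 ≤ D) : alpha D * Real.log (P1pp D) ≤ 521 * π := by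
  have hℓ : 1 < ell D := one_lt_ell hD
  have hP : 0 < bigP D ^ (0.496 : ℝ) := Real.rpow_pos_of_pos (Real.exp_pos _) _
  have hDpos : (0 : ℝ) < D := by exact_mod_cast (lt_of_lt_of_le (by norm_num) hD : 0 < D)
  have ht := t0_pos' hD
  have hP0 : 0 < bigP D := Real.exp_pos _
  have hlog : Real.log (P1pp D) = 0.496 * ell D ^ 9 + ell D + 519 * Real.log (ell D) := by
    rw [P1pp, Real.log_mul (mul_pos hP hDpos).ne' ht.ne', Real.log_mul hP.ne' hDpos.ne',
      Real.log_rpow hP0, log_bigP_eq', t0, Real.log_pow, ell]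
    push_cast; ring
  have hlogℓ : Real.log (ell D) ≤ ell D := (Real.log_le_sub_one_of_pos (by linarith)).trans (by linarith)
  have h9 : 0 < ell D ^ 9 := pow_pos (by linarith) _
  have h8 : ell D ≤ ell D ^ 9 := by
    calc ell D = ell D ^ 1 := (pow_one _).symm
      _ ≤ ell D ^ 9 := pow_le_pow_right₀ hℓ.le (by norm_num)
  rw [alpha_eq, hlog, div_mul_eq_mul_div, div_le_iff₀ h9]
  nlinarith [Real.pi_pos, mul_nonneg Real.pi_pos.le (sub_nonneg.mpr h8),
    mul_nonneg Real.pi_pos.le (sub_nonneg.mpr hlogℓ)]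

/-- `‖β₆‖ = 3α/2`, `Re β₆ = 0`. [cite: Zhang2022LandauSiegel, §2 (2.22)] -/
private theorem beta6_re' (D : ℕ) : (beta6 D).re = 0 := by simp [beta6]

/-- `‖β₆‖ = 3α/2`. [cite: Zhang2022LandauSiegel, §2 (2.22)] -/
private theorem norm_beta6' (hD : 3 ≤ D) : ‖beta6 D‖ = 3 * alpha D / 2 := by
  have hα := (alpha_pos_of' hD).le
  rw [beta6]; simp [Complex.norm_real, abs_of_nonneg hα]

/-- `β₆ − w ≠ 0` for `‖w‖ < 1.2α`. [cite: Zhang2022LandauSiegel, §12 proof of Lemma 12.2, p. 69] -/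
private theorem beta6_sub_ne_zero' (hD : 3 ≤ D) {w : ℂ} (hw : ‖w‖ < 1.2 * alpha D) :
    beta6 D - w ≠ 0 := by
  intro h
  have : w = beta6 D := (sub_eq_zero.mp h).symm
  rw [this, norm_beta6' hD] at hw
  linarith [alpha_pos_of' hD]

/-- Complex powers of positive reals multiply: `xᵉ·yᵉ = (xy)ᵉ`. [folklore] -/
private theorem ofReal_cpow_mul_ofReal_cpow {x y : ℝ} (hx : 0 < x) (hy : 0 < y) (e : ℂ) :
    (x : ℂ) ^ e * (y : ℂ) ^ e = ((x * y : ℝ) : ℂ) ^ e := by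
  rw [Complex.cpow_def_of_ne_zero (by exact_mod_cast hx.ne'),
    Complex.cpow_def_of_ne_zero (by exact_mod_cast hy.ne'),
    Complex.cpow_def_of_ne_zero (by exact_mod_cast (mul_pos hx hy).ne'), ← Complex.exp_add,
    ← Complex.ofReal_log hx.le, ← Complex.ofReal_log hy.le, ← Complex.ofReal_log (mul_pos hx hy).le,
    Real.log_mul hx.ne' hy.ne']
  push_cast; ring_nf

end Params122

/-! ## Holomorphy of `bracket122` and of the model integral near `|w| ≤ α` -/

section Holomorphy122

variable (c' : ℝ) {D : ℕ} [NeZero D] (χ : DirichletCharacter ℂ D)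

omit [NeZero D] in
/-- `bracket122` is entire in `w`. [cite: Zhang2022LandauSiegel, §12 proof of Lemma 12.2, p. 69] -/
theorem differentiable_bracket122 (hD : 3 ≤ D) (j d r : ℕ) (hd : 1 ≤ d) (hr : 1 ≤ r) :
    Differentiable ℂ (bracket122 c' χ j d r) := by
  have hX : 0 < ((d * r : ℕ) : ℝ) / P1pp D := by
    have : 1 ≤ d * r := Nat.one_le_iff_ne_zero.mpr (Nat.mul_ne_zero (by omega) (by omega))
    exact div_pos (by exact_mod_cast this) (P1pp_pos hD)
  have hXc : ((((d * r : ℕ) : ℝ) / P1pp D : ℝ) : ℂ) ≠ 0 := by exact_mod_cast hX.ne'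
  intro w
  unfold bracket122 innerSum
  refine DifferentiableAt.mul ?_ ?_
  · exact DifferentiableAt.const_cpow (by fun_prop) (Or.inl hXc)
  · refine DifferentiableAt.fun_sum fun l hl => ?_
    have hl1 : 1 ≤ l := (Finset.mem_Ico.mp (Finset.mem_filter.mp hl).1).1
    have hlc : (l : ℂ) ≠ 0 := by exact_mod_cast (by omega : l ≠ 0)
    refine DifferentiableAt.div (differentiableAt_const _) ?_ ?_
    · exact DifferentiableAt.const_cpow (by fun_prop) (Or.inl hlc)
    · exact fun h => hlc ((Complex.cpow_eq_zero_iff _ _).mp h).1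

omit [NeZero D] in
/-- The closed form of the model integral on `|w| < 1.2α`:
`∫₁^{P^{0.004}}y^{β₆−w−1}dy = (P^{0.004(β₆−w)} − 1)/(β₆ − w)`.
[cite: Zhang2022LandauSiegel, §12 proof of Lemma 12.2, pp. 69–70] -/
theorem modelInt026_eq_closedForm (hD : 3 ≤ D) {w : ℂ} (hw : ‖w‖ < 1.2 * alpha D) :
    modelInt026 D w = (((bigP D ^ (0.004 : ℝ) : ℝ) : ℂ) ^ (beta6 D - w) - 1) / (beta6 D - w) := by
  have hb : 0 < bigP D ^ (0.004 : ℝ) := Real.rpow_pos_of_pos (Real.exp_pos _) _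
  have hne : beta6 D - w ≠ 0 := beta6_sub_ne_zero' hD hw
  have h := integral_cpow (a := (1 : ℝ)) (b := bigP D ^ (0.004 : ℝ)) (r := beta6 D - w - 1)
    (Or.inr ⟨fun h => hne (by linear_combination h), Set.notMem_uIcc_of_lt zero_lt_one hb⟩)
  rw [modelInt026, h, sub_add_cancel, Complex.ofReal_one, Complex.one_cpow]

omit [NeZero D] in
/-- The model integral is holomorphic on `|w| < 1.2α`.
[cite: Zhang2022LandauSiegel, §12 proof of Lemma 12.2, pp. 69–70] -/
theorem differentiableOn_modelInt026 (hD : 3 ≤ D) :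
    DifferentiableOn ℂ (modelInt026 D) (ball (0 : ℂ) (1.2 * alpha D)) := by
  have hb : (((bigP D ^ (0.004 : ℝ) : ℝ) : ℂ)) ≠ 0 := by
    exact_mod_cast (Real.rpow_pos_of_pos (Real.exp_pos _) _).ne'
  intro w hw
  have hw' : ‖w‖ < 1.2 * alpha D := by simpa using hw
  have hne : beta6 D - w ≠ 0 := beta6_sub_ne_zero' hD hw'
  have hG : DifferentiableAt ℂ
      (fun w : ℂ => (((bigP D ^ (0.004 : ℝ) : ℝ) : ℂ) ^ (beta6 D - w) - 1) / (beta6 D - w)) w := by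
    refine DifferentiableAt.div ?_ (by fun_prop) hne
    exact (DifferentiableAt.const_cpow (by fun_prop) (Or.inl hb)).sub (differentiableAt_const _)
  refine (hG.congr_of_eventuallyEq ?_).differentiableWithinAt
  filter_upwards [isOpen_ball.mem_nhds hw] with z hz
  exact modelInt026_eq_closedForm hD (by simpa using hz)

omit [NeZero D] in
/-- **The identity behind "∂_w(∫₁^{P^{0.004}}y^{β₆−w−1}dy)"**: with u025's closed form,
`(dr/P″₁)^{β₆−w}·β_{j+1}β_{j+2}((P″₂/dr)^{β₆−w} − (P″₁/dr)^{β₆−w})/(β₆−w) = β_{j+1}β_{j+2}∫₁^{P^{0.004}}y^{β₆−w−1}dy`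
for `|w| < 1.2α` (`(dr/P″₁)(P″₂/dr) = P^{0.004}`, `(dr/P″₁)(P″₁/dr) = 1`).
[cite: Zhang2022LandauSiegel, §12 proof of Lemma 12.2, pp. 69–70, tex L3541] -/
theorem Xpow_mul_closedForm025 (hD : 3 ≤ D) (j d r : ℕ) (hd : 1 ≤ d) (hr : 1 ≤ r) {w : ℂ}
    (hw : ‖w‖ < 1.2 * alpha D) :
    ((((d * r : ℕ) : ℝ) / P1pp D : ℝ) : ℂ) ^ (beta6 D - w) *
        (betaJ c' D (j + 1) * betaJ c' D (j + 2) *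
          ((((P2pp D / ((d * r : ℕ) : ℝ) : ℝ) : ℂ) ^ (beta6 D - w) -
            ((P1pp D / ((d * r : ℕ) : ℝ) : ℝ) : ℂ) ^ (beta6 D - w)) / (beta6 D - w))) =
      betaJ c' D (j + 1) * betaJ c' D (j + 2) * modelInt026 D w := by
  have hdr : 0 < ((d * r : ℕ) : ℝ) := by
    have : 1 ≤ d * r := Nat.one_le_iff_ne_zero.mpr (Nat.mul_ne_zero (by omega) (by omega))
    exact_mod_cast this
  have hP1 : 0 < P1pp D := P1pp_pos hD
  have hP2 : 0 < P2pp D := P2pp_pos' hD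
  have hX : 0 < ((d * r : ℕ) : ℝ) / P1pp D := div_pos hdr hP1
  have hY2 : 0 < P2pp D / ((d * r : ℕ) : ℝ) := div_pos hP2 hdr
  have hY1 : 0 < P1pp D / ((d * r : ℕ) : ℝ) := div_pos hP1 hdr
  have e2 : ((((d * r : ℕ) : ℝ) / P1pp D : ℝ) : ℂ) ^ (beta6 D - w) *
      (((P2pp D / ((d * r : ℕ) : ℝ) : ℝ) : ℂ)) ^ (beta6 D - w) =
      (((bigP D ^ (0.004 : ℝ) : ℝ) : ℂ)) ^ (beta6 D - w) := by
    rw [ofReal_cpow_mul_ofReal_cpow hX hY2, ← P2pp_div_P1pp hD]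
    congr 2
    field_simp
  have e1 : ((((d * r : ℕ) : ℝ) / P1pp D : ℝ) : ℂ) ^ (beta6 D - w) *
      (((P1pp D / ((d * r : ℕ) : ℝ) : ℝ) : ℂ)) ^ (beta6 D - w) = 1 := by
    rw [ofReal_cpow_mul_ofReal_cpow hX hY1]
    have : ((d * r : ℕ) : ℝ) / P1pp D * (P1pp D / ((d * r : ℕ) : ℝ)) = 1 := by
      field_simp
    rw [this, Complex.ofReal_one, Complex.one_cpow]
  rw [modelInt026_eq_closedForm hD hw]
  have hne : beta6 D - w ≠ 0 := beta6_sub_ne_zero' hD hw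
  calc ((((d * r : ℕ) : ℝ) / P1pp D : ℝ) : ℂ) ^ (beta6 D - w) *
        (betaJ c' D (j + 1) * betaJ c' D (j + 2) *
          ((((P2pp D / ((d * r : ℕ) : ℝ) : ℝ) : ℂ) ^ (beta6 D - w) -
            ((P1pp D / ((d * r : ℕ) : ℝ) : ℝ) : ℂ) ^ (beta6 D - w)) / (beta6 D - w)))
      = betaJ c' D (j + 1) * betaJ c' D (j + 2) *
          ((((((d * r : ℕ) : ℝ) / P1pp D : ℝ) : ℂ) ^ (beta6 D - w) *
              (((P2pp D / ((d * r : ℕ) : ℝ) : ℝ) : ℂ)) ^ (beta6 D - w) -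
            ((((d * r : ℕ) : ℝ) / P1pp D : ℝ) : ℂ) ^ (beta6 D - w) *
              (((P1pp D / ((d * r : ℕ) : ℝ) : ℝ) : ℂ)) ^ (beta6 D - w)) / (beta6 D - w)) := by
        field_simp
    _ = betaJ c' D (j + 1) * betaJ c' D (j + 2) *
          (((((bigP D ^ (0.004 : ℝ) : ℝ) : ℂ)) ^ (beta6 D - w) - 1) / (beta6 D - w)) := by
        rw [e2, e1]

end Holomorphy122

/-! ## The Cauchy step u026 from u024 and u025 -/

section Cauchy122

variable (c' : ℝ) {D : ℕ} [NeZero D] (χ : DirichletCharacter ℂ D)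

omit [NeZero D] in
/-- On `|w| = α`, for `1 ≤ dr ≤ P″₁/T` (so `dr/P″₁ ≤ 1`): `|(dr/P″₁)^{β₆−w}| = (dr/P″₁)^{−Re w}
≤ (P″₁/dr)^{α} ≤ P″₁^{α} ≤ e^{521π}`. [cite: Zhang2022LandauSiegel, §12 proof of Lemma 12.2, p. 69] -/
theorem norm_Xpow_le_small (hD : 3 ≤ D) (d r : ℕ) (hd : 1 ≤ d) (hr : 1 ≤ r)
    (h1 : ((d * r : ℕ) : ℝ) ≤ P1pp D) {w : ℂ} (hw : ‖w‖ = alpha D) :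
    ‖((((d * r : ℕ) : ℝ) / P1pp D : ℝ) : ℂ) ^ (beta6 D - w)‖ ≤ Real.exp (521 * π) := by
  have hdr : 1 ≤ ((d * r : ℕ) : ℝ) := by
    have : 1 ≤ d * r := Nat.one_le_iff_ne_zero.mpr (Nat.mul_ne_zero (by omega) (by omega))
    exact_mod_cast this
  have hP1 : 0 < P1pp D := P1pp_pos hD
  have hα : 0 < alpha D := alpha_pos_of' hD
  set X : ℝ := ((d * r : ℕ) : ℝ) / P1pp D with hXdef
  have hX0 : 0 < X := div_pos (by linarith) hP1
  have hX1 : X ≤ 1 := (div_le_one hP1).mpr h1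
  rw [Complex.norm_cpow_eq_rpow_re_of_pos hX0, Complex.sub_re, beta6_re', zero_sub]
  have hre : -alpha D ≤ -w.re := by
    have := Complex.abs_re_le_norm w
    rw [hw] at this
    linarith [le_abs_self w.re]
  calc X ^ (-w.re) ≤ X ^ (-alpha D) := Real.rpow_le_rpow_of_exponent_ge hX0 hX1 hre
    _ = (X⁻¹) ^ alpha D := by rw [Real.rpow_neg hX0.le, Real.inv_rpow hX0.le]
    _ ≤ P1pp D ^ alpha D := by
        refine Real.rpow_le_rpow (inv_nonneg.mpr hX0.le) ?_ hα.le
        rw [hXdef, inv_div]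
        exact div_le_self hP1.le hdr
    _ = Real.exp (alpha D * Real.log (P1pp D)) := by
        rw [Real.rpow_def_of_pos hP1, mul_comm]
    _ ≤ Real.exp (521 * π) := Real.exp_le_exp.mpr (alpha_mul_log_P1pp_le hD)

/-- **Z22:§12.u026 (with its factor) from u024 and u025.** If on `|w| = α` the inner sum equals the
Perron integral up to `O(𝓛⁻¹⁵)` (u024) and the Perron integral equals `L′(1,χ)Π(d,r)·circ025(w)` up to
`O(𝓛⁻¹⁵)` with `circ025` in closed form (u025), then
`∂_w bracket122|_{w=0} = L′(1,χ)Π(d,r)β_{j+1}β_{j+2}·∂_w(∫₁^{P^{0.004}}y^{β₆−w−1}dy)|_{w=0} + O(𝓛⁻⁶)`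
— Cauchy's estimate for `E(w) = bracket122(w) − L′Πβ_{j+1}β_{j+2}·modelInt026(w)` on `|w| = α`.
Kernel-checked: the node `U026read` is PROVED modulo the two analytic displays.
[cite: Zhang2022LandauSiegel, §12 proof of Lemma 12.2, pp. 69–70, tex L3541] -/
theorem u026read_of_u024_u025 (h24 : U024 c') (h25 : U025 c') : U026read c' := by
  obtain ⟨C₁, h24'⟩ := h24
  obtain ⟨C₂, h25'⟩ := h25
  obtain ⟨D₀, hall⟩ := h24'.and h25'
  refine ⟨Real.exp (521 * π) * (|C₁| + |C₂|) / π, max D₀ 3,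
    fun D _ χ hD hq hp hA j hj d r hd hr h1 => ?_⟩
  have hD₀ : D₀ ≤ D := le_trans (le_max_left _ _) hD
  have hD3 : 3 ≤ D := le_trans (le_max_right _ _) hD
  obtain ⟨k24, k25⟩ := hall D χ hD₀ hq hp
  have hα : 0 < alpha D := alpha_pos_of' hD3
  have hℓ : 0 < ell D := by linarith [one_lt_ell hD3]
  have hT : 1 ≤ bigT D := by rw [bigT]; exact Real.one_le_exp (by positivity)
  have h1' : ((d * r : ℕ) : ℝ) ≤ P1pp D := h1.trans (div_le_self (P1pp_pos hD3).le hT)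
  set L : ℂ := deriv χ.LFunction 1 * PiW χ d r with hL
  set B : ℂ := betaJ c' D (j + 1) * betaJ c' D (j + 2) with hB
  set E : ℂ → ℂ := fun w => bracket122 c' χ j d r w - L * B * modelInt026 D w with hE
  -- the bound on the circle
  have hcirc : ∀ w ∈ sphere (0 : ℂ) (alpha D), ‖E w‖ ≤
      Real.exp (521 * π) * ((|C₁| + |C₂|) * (ell D ^ 15)⁻¹) := by
    intro w hw
    have hw' : ‖w‖ = alpha D := by simpa using hw
    have hwlt : ‖w‖ < 1.2 * alpha D := by rw [hw']; linarith
    obtain ⟨-, e24⟩ := k24 hA j hj d r hd hr h1 w hw'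
    obtain ⟨e25, e25'⟩ := k25 hA j hj d r hd hr h1 w hw'
    have hid : E w = ((((d * r : ℕ) : ℝ) / P1pp D : ℝ) : ℂ) ^ (beta6 D - w) *
        (innerSum c' χ j d r w - L * circ025 c' D j d r w) := by
      have key := Xpow_mul_closedForm025 c' hD3 j d r hd hr hwlt
      rw [← e25'] at key
      simp only [hE, bracket122]
      linear_combination L * key
    rw [hid, norm_mul]
    have hin : ‖innerSum c' χ j d r w - L * circ025 c' D j d r w‖ ≤ (|C₁| + |C₂|) * (ell D ^ 15)⁻¹ := by
      have h15 : 0 ≤ (ell D ^ 15)⁻¹ := inv_nonneg.mpr (pow_nonneg hℓ.le _)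
      calc ‖innerSum c' χ j d r w - L * circ025 c' D j d r w‖
          ≤ ‖innerSum c' χ j d r w - lineInt024 c' χ j d r w‖ +
              ‖lineInt024 c' χ j d r w - L * circ025 c' D j d r w‖ := norm_sub_le_norm_sub_add_norm_sub _ _ _
        _ ≤ C₁ * (ell D ^ 15)⁻¹ + C₂ * (ell D ^ 15)⁻¹ := add_le_add e24 e25
        _ ≤ |C₁| * (ell D ^ 15)⁻¹ + |C₂| * (ell D ^ 15)⁻¹ := by
            gcongr <;> exact le_abs_self _
        _ = (|C₁| + |C₂|) * (ell D ^ 15)⁻¹ := by ring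
    exact mul_le_mul (norm_Xpow_le_small hD3 d r hd hr h1' hw') hin (norm_nonneg _)
      (Real.exp_pos _).le
  -- holomorphy on a neighbourhood of the closed disc
  have hdiff : DiffContOnCl ℂ E (ball (0 : ℂ) (alpha D)) := by
    have hsub : closedBall (0 : ℂ) (alpha D) ⊆ ball (0 : ℂ) (1.2 * alpha D) :=
      closedBall_subset_ball (by linarith)
    refine DifferentiableOn.diffContOnCl_ball (U := ball (0 : ℂ) (1.2 * alpha D)) ?_ hsub
    exact ((differentiable_bracket122 c' χ hD3 j d r hd hr).differentiableOn).sub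
      ((differentiableOn_modelInt026 hD3).const_mul _)
  have hderiv := Complex.norm_deriv_le_of_forall_mem_sphere_norm_le hα hdiff hcirc
  -- split the derivative
  have hBr : DifferentiableAt ℂ (bracket122 c' χ j d r) 0 :=
    (differentiable_bracket122 c' χ hD3 j d r hd hr) 0
  have hM : DifferentiableAt ℂ (modelInt026 D) 0 :=
    (differentiableOn_modelInt026 hD3).differentiableAt
      (isOpen_ball.mem_nhds (mem_ball_self (by positivity)))
  have hsplit : deriv E 0 = deriv (bracket122 c' χ j d r) 0 - L * B * deriv (modelInt026 D) 0 := by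
    simp only [hE]
    rw [deriv_fun_sub hBr (hM.const_mul _), deriv_const_mul _ hM]
  rw [hsplit, hL, hB] at hderiv
  have hrw : deriv χ.LFunction 1 * PiW χ d r * (betaJ c' D (j + 1) * betaJ c' D (j + 2)) *
      deriv (modelInt026 D) 0 =
      deriv χ.LFunction 1 * PiW χ d r * betaJ c' D (j + 1) * betaJ c' D (j + 2) *
        deriv (modelInt026 D) 0 := by ring
  rw [hrw] at hderiv
  refine hderiv.trans (le_of_eq ?_)
  rw [alpha_eq]
  have h9 : ell D ^ 9 ≠ 0 := pow_ne_zero _ hℓ.ne'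
  have h15 : ell D ^ 15 ≠ 0 := pow_ne_zero _ hℓ.ne'
  have h6 : ell D ^ 6 ≠ 0 := pow_ne_zero _ hℓ.ne'
  field_simp

end Cauchy122

/-! ## (12.10) with the rate `O(𝓛⁻¹⁵)`, and Lemma 12.2 from its steps plus (12.11) -/

section Edges122

variable (c' : ℝ)

/-- **(12.10) with `O(𝓛⁻¹⁵)` from u023, u026 (with its factor) and u027**: for `dr < P″₁/T`,
`Σ_l χ(l)ϰ̄₁₃(drl)ξ_j(l;d,r)/l = b*L′(1,χ)Π(d,r)(log P)β_{j+1}β_{j+2} + O(𝓛⁻¹⁵)` — the algebra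
`−(1/log P₁)·L′Πβ_{j+1}β_{j+2}·(−(log P)²∫₀^{0.004}ze^{3πiz/2}dz) = b*L′Π(log P)β_{j+1}β_{j+2}`
(`log P₁ = 0.504 log P`) and the error `O(𝓛⁻⁶)/log P₁ = O(𝓛⁻¹⁵)`. Kernel-checked.
[cite: Zhang2022LandauSiegel, §12 Lemma 12.2 (12.10) and its proof, pp. 69–70, tex L3503–L3548] -/
theorem eq1210L15_of_steps (h23 : U023 c') (h26 : U026read c') (h27 : U027) : Eq1210L15 c' := by
  obtain ⟨C, h26'⟩ := h26
  obtain ⟨D₀, hall⟩ := (h23.and h26').and h27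
  refine ⟨C / 0.504, max D₀ 3, fun D _ χ hD hq hp hA j hj d r hd hr h1 => ?_⟩
  have hD₀ : D₀ ≤ D := le_trans (le_max_left _ _) hD
  have hD3 : 3 ≤ D := le_trans (le_max_right _ _) hD
  obtain ⟨⟨k23, k26⟩, k27⟩ := hall D χ hD₀ hq hp
  have e23 := k23 j hj d r hd hr
  have e26 := k26 hA j hj d r hd hr h1.le
  have hℓ : 0 < ell D := by linarith [one_lt_ell hD3]
  have hlogP : 0 < Real.log (bigP D) := by rw [log_bigP_eq']; exact pow_pos hℓ _
  have hlogP1 : 0 < Real.log (Skeleton.P1 D) := log_P1_pos' hD3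
  have hlogc : (Real.log (Skeleton.P1 D) : ℂ) ≠ 0 := by exact_mod_cast hlogP1.ne'
  have hlogPc : (Real.log (bigP D) : ℂ) ≠ 0 := by exact_mod_cast hlogP.ne'
  set L : ℂ := deriv χ.LFunction 1 * PiW χ d r with hL
  set B : ℂ := betaJ c' D (j + 1) * betaJ c' D (j + 2) with hB
  -- the main term: −(1/log P₁)·L·β'β''·(deriv modelInt026 0) = main1210
  have hmain : -(1 / (Real.log (Skeleton.P1 D) : ℂ)) *
      (L * betaJ c' D (j + 1) * betaJ c' D (j + 2) * deriv (modelInt026 D) 0) = main1210 c' χ j d r := by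
    rw [k27, main1210, bstar_eq_display, hL]
    set J : ℂ := ∫ z in (0 : ℝ)..0.004, (z : ℂ) * cexp (3 * π * I * z / 2) with hJ
    have hP1c : (Real.log (Skeleton.P1 D) : ℂ) = 0.504 * (Real.log (bigP D) : ℂ) := by
      rw [log_P1_eq']; push_cast; ring
    rw [hP1c]
    push_cast
    field_simp
  -- the identity for the difference
  have hid : sum122 c' χ j d r - main1210 c' χ j d r =
      -(1 / (Real.log (Skeleton.P1 D) : ℂ)) *
        (deriv (bracket122 c' χ j d r) 0 -
          L * betaJ c' D (j + 1) * betaJ c' D (j + 2) * deriv (modelInt026 D) 0) := by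
    rw [e23, ← hmain]; ring
  rw [hid, norm_mul, norm_neg, norm_div, norm_one, Complex.norm_real, Real.norm_eq_abs,
    abs_of_pos hlogP1]
  have hval : 1 / Real.log (Skeleton.P1 D) * (C * (ell D ^ 6)⁻¹) = C / 0.504 * (ell D ^ 15)⁻¹ := by
    rw [log_P1_eq', log_bigP_eq']
    have h9 : ell D ^ 9 ≠ 0 := pow_ne_zero _ hℓ.ne'
    have h6 : ell D ^ 6 ≠ 0 := pow_ne_zero _ hℓ.ne'
    have h15 : ell D ^ 15 ≠ 0 := pow_ne_zero _ hℓ.ne'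
    field_simp
  calc 1 / Real.log (Skeleton.P1 D) *
        ‖deriv (bracket122 c' χ j d r) 0 -
          L * betaJ c' D (j + 1) * betaJ c' D (j + 2) * deriv (modelInt026 D) 0‖
      ≤ 1 / Real.log (Skeleton.P1 D) * (C * (ell D ^ 6)⁻¹) :=
        mul_le_mul_of_nonneg_left e26 (by positivity)
    _ = C / 0.504 * (ell D ^ 15)⁻¹ := hval

/-- **Lemma 12.2 (with the rate `O(𝓛⁻¹⁵)` for (12.10)) from the displayed steps u023–u027 plus (12.11)**
— (12.11)'s printed proof is "similar to that of ." (blank reference; GAP row G-L3t5-2), so `Eq1211`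
is a hypothesis. [cite: Zhang2022LandauSiegel, §12 Lemma 12.2 and its proof, pp. 69–70, tex L3502–L3549] -/
theorem lemma122L15_of_steps (h23 : U023 c') (h24 : U024 c') (h25 : U025 c') (h27 : U027)
    (h1211 : Eq1211 c') : Lemma122 c' (fun D => (ell D ^ 15)⁻¹) :=
  ⟨eq1210L15_of_steps c' h23 (u026read_of_u024_u025 c' h24 h25) h27, h1211⟩

/-- **The deduction node `Ded122` (at the rate `O(𝓛⁻¹⁵)`) holds GIVEN the displayed steps and (12.11)**:
its printed antecedents Lemmas 8.2–8.4 and 5.8 enter only through u024/u025.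
[cite: Zhang2022LandauSiegel, §12 proof of Lemma 12.2, pp. 69–70, tex L3518] -/
theorem ded122L15_of_steps (h23 : U023 c') (h24 : U024 c') (h25 : U025 c') (h27 : U027)
    (h1211 : Eq1211 c') : Ded122 c' (fun D => (ell D ^ 15)⁻¹) :=
  fun _ _ _ _ => lemma122L15_of_steps c' h23 h24 h25 h27 h1211

end Edges122

end Literature.NumberTheory.LFunctions.Zhang2022.Typed.Sec12B
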